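import Summits.ABC.IUTFork.ForkGenuineRatInputsDH
import HarnessLib

/-!
# FACT-LIST SCHEMA row F-2684 `ThetaVolumeInput.HullEstimateOf` — decided at GENUINE data over `ℚ/ℚ`

PROOF-ONLY companion (0 `def`, 0 `instance`, 0 notation) of the abc-iut cell, block F (seat abc-iut-f-135, gen 8;
director-abc g4 ROW SUPPLY `ROWS-LF-0348.tsv` row 98 «decide the label»). It imports — never edits —
`Literature.IUT.LogVolume.GenuineLogTheta` (abc-iut-S2's `ThetaVolumeInput.HullEstimateOf I δ`: "the nonarchimedean part
of `−|log(Θ)|` is at most `−deĝ̲_lgp(P_Θ) + δ`", [IUTchIV] Thm. 1.10 Steps (v)–(viii) shape, Dupuy–Hilado's `EstimateDH`)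
through the skeleton seat's `ForkGenuineRatInputs` (`negLogThetaNonarch_rat_eq`: over `F₀ = K = ℚ` the nonarchimedean
`−|log(Θ)|` equals `−deĝ̲_lgp(P_Θ)` EXACTLY, for every input) and `ForkGenuineRatInputsDH` (a rational input EXISTS:
`exists_rat_input_cor312Of_and_not_cor312NonarchOf`).

* `hullEstimateOf_rat_iff` — for EVERY genuine Θ-volume input `I` over `ℚ/ℚ` and every `δ : ℝ`:
  `I.HullEstimateOf δ ↔ 0 ≤ δ` (the discrepancy to be paid is exactly zero over `ℚ/ℚ`).
* `not_forall_hullEstimateOf` — the ∀-closure of the schema over its free signature `(F₀, K, I, δ)` is REFUTED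
  (`δ = −1` at a rational input): the free real binder `δ` makes the universal closure trivially false, so the row's
  CONTENT is its instance forms at explicit `δ` (`hullEstimateOf_ofInput`, `hullEstimateOf_slotResidue_add_rest`, … —
  untouched, cited by name).
* `exists_hullEstimateOf` — INHABITED at genuine data (`δ = 0` at a rational input).

HONEST FRAMING: over `ℚ/ℚ` an "input" is pilot data with ideles in the completions `ℚ_p` (not a collection of initial
Θ-data, whose `K ⊋ ℚ`); the certificate decides a LABEL of OUR typed schema and says nothing about [IUTchIV] Thm. 1.10's
estimate at initial Θ-data, nor about [IUTchIII] Cor. 3.12; no side is taken on any author. A FACT row is an assumption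
label on OUR typed statement; typed ≠ proved. [cite: Mochizuki2012, IUTchIV Thm. 1.10 Steps (v)–(viii) p. 27–31]
-/

noncomputable section

namespace Summit.ABC.IUTFork.GenuineContent

open Literature.IUT.LogVolume

/-! ## F-2684 `ThetaVolumeInput.HullEstimateOf` over `ℚ/ℚ` -/

/-- **The computable half over `ℚ/ℚ` is decided for every input and every `δ`**: since `−|log(Θ)|^nonarch = −deĝ̲_lgp(P_Θ)`
exactly (`negLogThetaNonarch_rat_eq`), `HullEstimateOf I δ ↔ 0 ≤ δ`.
[cite: Mochizuki2012, IUTchIV Thm. 1.10 Steps (v)–(viii) p. 27–31] -/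
theorem hullEstimateOf_rat_iff (I : ThetaVolumeInput ℚ ℚ) (δ : ℝ) : I.HullEstimateOf δ ↔ 0 ≤ δ := by
  unfold ThetaVolumeInput.HullEstimateOf
  rw [negLogThetaNonarch_rat_eq I]
  constructor <;> intro h <;> linarith

/-- **F-2684, ∀-closure REFUTED at genuine data**: the schema `HullEstimateOf I δ` is not a theorem of its free signature —
at any rational input (the tree's `exists_rat_input_cor312Of_and_not_cor312NonarchOf`) it fails for `δ = −1`.
[cite: Mochizuki2012, IUTchIV Thm. 1.10 Steps (v)–(viii) p. 27–31] -/
theorem not_forall_hullEstimateOf :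
    ¬ ∀ (F₀ : Type) [Field F₀] [NumberField F₀] (K : Type) [Field K] [NumberField K] [Algebra F₀ K]
        (I : ThetaVolumeInput F₀ K) (δ : ℝ), I.HullEstimateOf δ := by
  intro h
  obtain ⟨I, -, -⟩ := exists_rat_input_cor312Of_and_not_cor312NonarchOf
  have h1 : (0 : ℝ) ≤ -1 := (hullEstimateOf_rat_iff I (-1)).mp (h ℚ ℚ I (-1))
  linarith

/-- **F-2684, INHABITED at genuine data**: at a rational input the computable half holds with discrepancy `δ = 0`
(and, for every input over any `F₀ ⊆ K`, with the explicit `δ` of `hullEstimateOf_ofInput` /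
`hullEstimateOf_slotResidue_add_rest` — by name). [cite: Mochizuki2012, IUTchIV Thm. 1.10 Steps (v)–(viii) p. 27–31] -/
theorem exists_hullEstimateOf :
    ∃ (F₀ : Type) (_ : Field F₀) (_ : NumberField F₀) (K : Type) (_ : Field K) (_ : NumberField K) (_ : Algebra F₀ K)
        (I : ThetaVolumeInput F₀ K) (δ : ℝ), I.HullEstimateOf δ := by
  obtain ⟨I, -, -⟩ := exists_rat_input_cor312Of_and_not_cor312NonarchOf
  exact ⟨ℚ, inferInstance, inferInstance, ℚ, inferInstance, inferInstance, inferInstance, I, 0,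
    (hullEstimateOf_rat_iff I 0).mpr le_rfl⟩

end Summit.ABC.IUTFork.GenuineContent

end
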